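import Mathlib
import HarnessLib
import Literature.Analysis.FluidPDE.SuitableWeak
import Literature.Analysis.FluidPDE.SelfSimilar
import Literature.Analysis.FluidPDE.LocalTypeI
import Literature.Analysis.FluidPDE.SpaceTimeRescaling
import Literature.Analysis.FluidPDE.LocalTypeIScaling
import Literature.Analysis.FluidPDE.LocalTypeICongr
import Literature.Analysis.FluidPDE.LocalTypeIReverseZoom
import Literature.Analysis.FluidPDE.SlabTypeICompactness
import Literature.Analysis.FluidPDE.TypeIRateOseenMildRepresentative
import Literature.Analysis.FluidPDE.OseenMildUniqueness
import Summits.NavierStokesRegularity.NavierStokesRegularity.Theorems.RellichScarApexLocalisationSpherePersistence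

/-!
# Parabolic activity at a singular point (line activity-genealogy-fission, crux ApexLocalisation,
# stub `stub_parabolicActivity`)

The class of the line: suitable weak solutions `(u, p)` of Navier–Stokes on the backward slab
`𝕊 = (-∞, 0) × ℝ³` with weak spatial gradient `G`, Albritton–Barker quantity `𝐈(u,p,G) ≤ I`,
the Type-I rate `‖u(t,x)‖ ≤ C/√(−t)` (`HasTypeITimeDecay C u`), continuous on the open slab.

`stub_parabolicActivity` (Barker–Prange 2020, Thm. 2, in qualitative slab-class form): for every
class `(C, I)`, `I < ⊤`, there are `η > 0` and `ρ > 0` such that every continuous class profile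
which is backward-singular at the space–time origin is `η`-ACTIVE somewhere in the unit time band
below the vertex: `√(−t) ‖u(t, x)‖ ≥ η` at some `t ∈ (-2, -1)`, `‖x‖ ≤ ρ`.

Proof (contradiction; Albritton–Barker 2019, Lemma 2.2 + Prop. 2.3 on the slab = the tree's ENGINE
`slab_typeI_compactness`; forward uniqueness of bounded Oseen-mild solutions, KNSS 2009 §4):

1. if no `(η, ρ)` works, pick for `η_k = 1/(k+1)`, `ρ_k = k+1` an origin-singular continuous class
   profile `u_k` with `√(−t) ‖u_k(t, x)‖ < η_k` on `(-2, -1) × B̄(0, ρ_k)`;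
2. the ENGINE extracts `σ` and a limit `(v₀, q, H)` with `𝐈 ≤ 4 I` and `u_{σ j} → v₀` in
   `L³(Q(0, R))` for every `R > 0`; persistence at the FIXED origin (every `u_{σ j}` is singular
   there, so `‖u_{σ j}‖_{L^∞(Q(0,R))} = ∞`) makes the origin a backward singular point of `v₀`;
3. the rate passes to `v₀` a.e. (`ae_rate_of_tendsto_eLpNorm`), `exists_repr_hasTypeITimeDecay`
   gives a representative with the pointwise rate and `exists_oseenMild_repr_of_typeIBound_lt_top`
   a CONTINUOUS, OSEEN-MILD one `v` keeping the rate (`v(t) = e^{(t−s)Δ} v(s) − B¹ₛ(v,v)(t)` for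
   all `s < t < 0`); the class data, the singular origin and the `L³_loc` convergence are
   transferred along the a.e. equalities (`classData_congr_ae`);
4. at every point of the band `(-2, -1) × ℝ³` the approximants tend to `0`
   (`‖u_{σ j}(t, x)‖ ≤ √(−t) ‖u_{σ j}(t, x)‖ < η_{σ j}` once `ρ_{σ j} ≥ ‖x‖`), so `v = 0` a.e. on
   the band (a.e.-convergent subsequences ball by ball), hence everywhere on the open band by
   continuity (`Measure.eqOn_open_of_ae_eq`);
5. forward uniqueness from the zero slice `s = -3/2` (`oseenMild_bounded_unique`, comparing `v`
   with the zero field on `(-3/2, t/2)`, free term `e^{(t+3/2)Δ} 0 = 0`): `v(t) = 0` a.e., hence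
   everywhere (continuous slices), for all `-3/2 < t < 0`;
6. so `‖v‖_{L^∞(Q(0,1))} = 0 ≠ ∞`: the origin is not singular for `v` — a contradiction.

## References

* T. Barker, C. Prange, *Localized smoothing for the Navier–Stokes equations and concentration of
  critical norms near singularities*, Arch. Ration. Mech. Anal. 236 (2020) = arXiv:1812.09115,
  Thm. 2. [BarkerPrange2020]
* D. Albritton, T. Barker, *On local Type I singularities of the Navier–Stokes equations and
  Liouville theorems*, J. Math. Fluid Mech. 21 (2019) = arXiv:1811.00502, Lemma 2.2, Prop. 2.3,
  §3. [AlbrittonBarker2019]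
* G. Koch, N. Nadirashvili, G. Seregin, V. Šverák, *Liouville theorems for the Navier–Stokes
  equations and applications*, Acta Math. 203 (2009) = arXiv:0709.3599, §4 (4.3)–(4.4).
  [KochNadirashviliSereginSverak2009]
-/

set_option linter.dupNamespace false

namespace Summit.NavierStokesRegularity.NavierStokesRegularity.Theorems.RellichScarApexLocalisation

open MeasureTheory Set Function Metric Filter Topology TopologicalSpace
open scoped ENNReal NNReal
open Literature.Analysis Literature.Analysis.FluidPDE

/-! ### Tool 1: pointwise-vanishing approximants have an a.e.-vanishing `L³_loc` limit -/

-- adapted from `ae_quiet_of_eventually_quiet_of_tendsto_eLpNorm`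
-- (Theorems/RellichScarApexLocalisationCleanTrunkCompactness.lean)
/-- **Pointwise-vanishing approximants have an a.e.-vanishing `L³_loc` limit.** If measurable
fields `W j` converge to a measurable `v` in `L³(Q(0, n+1))` for every `n`, and `W j (t, x) → 0`
at every point `(t, x)` of a set `S`, then `v = 0` a.e. on the part of the slab inside `S`
(a.e.-convergent subsequences ball by ball, uniqueness of limits; the balls `Q(0, n+1)` exhaust
the slab). -/
theorem ae_zero_of_tendsto_zero_of_tendsto_eLpNorm
    {W : ℕ → ℝ → (EuclideanSpace ℝ (Fin 3)) → (EuclideanSpace ℝ (Fin 3))}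
    {v : ℝ → (EuclideanSpace ℝ (Fin 3)) → (EuclideanSpace ℝ (Fin 3))}
    {S : Set (ℝ × (EuclideanSpace ℝ (Fin 3)))}
    (hWm : ∀ j, AEStronglyMeasurable (uncurry (W j))
      (volume.restrict (Iio (0 : ℝ) ×ˢ (univ : Set (EuclideanSpace ℝ (Fin 3))))))
    (hvm : AEStronglyMeasurable (uncurry v)
      (volume.restrict (Iio (0 : ℝ) ×ˢ (univ : Set (EuclideanSpace ℝ (Fin 3))))))
    (hW0 : ∀ z ∈ S, Tendsto (fun j => uncurry (W j) z) atTop (𝓝 0))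
    (hL3 : ∀ n : ℕ, Tendsto (fun j => eLpNorm (uncurry (W j) - uncurry v) 3
      (volume.restrict (parabolicCylinder ((n : ℝ) + 1) (0 : ℝ × (EuclideanSpace ℝ (Fin 3))))))
      atTop (𝓝 0)) :
    ∀ᵐ z ∂(volume.restrict (Iio (0 : ℝ) ×ˢ (univ : Set (EuclideanSpace ℝ (Fin 3))))),
      z ∈ S → uncurry v z = 0 := by
  refine ae_restrict_of_ae_restrict_of_subset lowerHalf_subset_iUnion_parabolicCylinder ?_
  rw [ae_restrict_iUnion_iff]
  intro n
  have hQ₀s : parabolicCylinder ((n : ℝ) + 1) (0 : ℝ × (EuclideanSpace ℝ (Fin 3))) ⊆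
      Iio (0 : ℝ) ×ˢ (univ : Set (EuclideanSpace ℝ (Fin 3))) :=
    parabolicCylinder_origin_subset_slab _
  have hWm' : ∀ j, AEStronglyMeasurable (uncurry (W j)) (volume.restrict
      (parabolicCylinder ((n : ℝ) + 1) (0 : ℝ × (EuclideanSpace ℝ (Fin 3))))) := fun j =>
    (hWm j).mono_measure (Measure.restrict_mono hQ₀s le_rfl)
  have hvm' : AEStronglyMeasurable (uncurry v) (volume.restrict
      (parabolicCylinder ((n : ℝ) + 1) (0 : ℝ × (EuclideanSpace ℝ (Fin 3))))) :=
    hvm.mono_measure (Measure.restrict_mono hQ₀s le_rfl)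
  have hTIM : TendstoInMeasure (volume.restrict
      (parabolicCylinder ((n : ℝ) + 1) (0 : ℝ × (EuclideanSpace ℝ (Fin 3)))))
      (fun j => uncurry (W j)) atTop (uncurry v) :=
    tendstoInMeasure_of_tendsto_eLpNorm (by norm_num) hWm' hvm' (hL3 n)
  obtain ⟨ns, hns, hae⟩ := hTIM.exists_seq_tendsto_ae
  filter_upwards [hae] with z hz
  intro hzS
  exact tendsto_nhds_unique hz ((hW0 z hzS).comp hns.tendsto_atTop)

/-! ### Tool 2: a.e. vanishing on an open time band is vanishing, for continuous fields -/

/-- **A.e. vanishing on a time band is vanishing, for continuous fields.** If `v` is continuous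
on the open slab, `b ≤ 0`, and `v = 0` a.e. on the part `(a, b) × ℝ³` of the slab, then
`v(t, x) = 0` for all `t ∈ (a, b)` and all `x` (two continuous functions a.e. equal on an open
set agree there, `Measure.eqOn_open_of_ae_eq`). -/
theorem band_zero_of_ae_zero_of_continuousOn
    {v : ℝ → (EuclideanSpace ℝ (Fin 3)) → (EuclideanSpace ℝ (Fin 3))} {a b : ℝ} (hb : b ≤ 0)
    (hvcont : ContinuousOn (uncurry v) (Iio (0 : ℝ) ×ˢ univ))
    (hae : ∀ᵐ z ∂(volume.restrict (Iio (0 : ℝ) ×ˢ (univ : Set (EuclideanSpace ℝ (Fin 3))))),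
      z ∈ Ioo a b ×ˢ (univ : Set (EuclideanSpace ℝ (Fin 3))) → uncurry v z = 0) :
    ∀ t ∈ Ioo a b, ∀ x : EuclideanSpace ℝ (Fin 3), v t x = 0 := by
  have hOs : Ioo a b ×ˢ (univ : Set (EuclideanSpace ℝ (Fin 3))) ⊆ Iio (0 : ℝ) ×ˢ univ :=
    prod_mono (fun t ht => ht.2.trans_le hb) Subset.rfl
  have hOopen : IsOpen (Ioo a b ×ˢ (univ : Set (EuclideanSpace ℝ (Fin 3)))) :=
    isOpen_Ioo.prod isOpen_univ
  have hae' : uncurry v =ᵐ[volume.restrict (Ioo a b ×ˢ (univ : Set (EuclideanSpace ℝ (Fin 3))))]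
      fun _ => (0 : EuclideanSpace ℝ (Fin 3)) := by
    filter_upwards [ae_restrict_of_ae_restrict_of_subset hOs hae,
      ae_restrict_mem hOopen.measurableSet] with z hz hzO
    exact hz hzO
  have hEq := Measure.eqOn_open_of_ae_eq hae' hOopen (hvcont.mono hOs) continuousOn_const
  intro t ht x
  exact hEq (mk_mem_prod ht (mem_univ x))

/-! ### Tool 3: forward uniqueness from a zero slice -/

/-- **A continuous Oseen-mild rate profile vanishing on a slice vanishes afterwards** (forward
uniqueness of bounded solutions of the Oseen integral equation, KNSS 2009 §4 (4.3)–(4.4) =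
`oseenMild_bounded_unique`): if `v` is continuous on the open slab with the rate `C/√(−t)`,
solves `v(t) = e^{(t−s)Δ} v(s) − B¹ₛ(v, v)(t)` pointwise for all `s < t < 0`, and `v(s₀) = 0`
for some `s₀ < 0`, then `v(t, x) = 0` for all `s₀ < t < 0` and all `x`: on `(s₀, t/2)` both
`v` and the zero field are bounded by `C/√(−t/2)` and solve the equation with the free term
`e^{(t−s₀)Δ} 0 = 0`, so `v(t) = 0` a.e., hence everywhere by continuity of the slice.
[cite: KochNadirashviliSereginSverak2009, §4 (4.3)–(4.4) (arXiv:0709.3599 p. 8)] -/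
theorem zero_after_zero_slice_of_oseenMild
    {v : ℝ → (EuclideanSpace ℝ (Fin 3)) → (EuclideanSpace ℝ (Fin 3))} {C s₀ : ℝ} (hs₀ : s₀ < 0)
    (hvcont : ContinuousOn (uncurry v) (Iio (0 : ℝ) ×ˢ univ))
    (hvC : HasTypeITimeDecay C v)
    (hmild : ∀ s t : ℝ, s < t → t < 0 → ∀ x,
      v t x = UnboundedOperators.heatExtension (v s) (t - s) x - oseenDuhamel 1 s v v t x)
    (hzero : ∀ x, v s₀ x = 0) :
    ∀ t : ℝ, s₀ < t → t < 0 → ∀ x : EuclideanSpace ℝ (Fin 3), v t x = 0 := by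
  -- `0 ≤ C` (the rate at `(s₀, 0)`)
  have hC0 : 0 ≤ C := by
    have ha : 0 < Real.sqrt (-s₀) := Real.sqrt_pos.2 (neg_pos.2 hs₀)
    have h1 : 0 ≤ C / Real.sqrt (-s₀) := (norm_nonneg _).trans (hvC s₀ hs₀ 0)
    have h2 := (le_div_iff₀ ha).1 h1
    simpa using h2
  have hz : v s₀ = fun _ => 0 := funext hzero
  intro t hst ht0
  -- uniqueness on the window `(s₀, t/2)`
  have hT0 : t / 2 < 0 := by linarith
  have htT : t < t / 2 := by linarith
  have hM0 : 0 ≤ C / Real.sqrt (-(t / 2)) := div_nonneg hC0 (Real.sqrt_nonneg _)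
  have hsub : Ioo s₀ (t / 2) ×ˢ (univ : Set (EuclideanSpace ℝ (Fin 3))) ⊆ Iio (0 : ℝ) ×ˢ univ :=
    prod_mono (fun τ hτ => hτ.2.trans hT0) Subset.rfl
  have hum : AEStronglyMeasurable (uncurry v)
      ((volume : Measure (ℝ × EuclideanSpace ℝ (Fin 3))).restrict (Ioo s₀ (t / 2) ×ˢ univ)) :=
    (hvcont.mono hsub).aestronglyMeasurable (measurableSet_Ioo.prod MeasurableSet.univ)
  have hzm : AEStronglyMeasurable
      (uncurry (0 : ℝ → EuclideanSpace ℝ (Fin 3) → EuclideanSpace ℝ (Fin 3)))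
      ((volume : Measure (ℝ × EuclideanSpace ℝ (Fin 3))).restrict (Ioo s₀ (t / 2) ×ˢ univ)) :=
    aestronglyMeasurable_const
  have huM : ∀ τ ∈ Ioo s₀ (t / 2), ∀ y, ‖v τ y‖ ≤ C / Real.sqrt (-(t / 2)) := fun τ hτ y => by
    have hτ0 : τ < 0 := hτ.2.trans hT0
    refine (hvC τ hτ0 y).trans ?_
    exact div_le_div_of_nonneg_left hC0 (Real.sqrt_pos.2 (neg_pos.2 hT0))
      (Real.sqrt_le_sqrt (by linarith [hτ.2]))
  have hvM : ∀ τ ∈ Ioo s₀ (t / 2), ∀ y,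
      ‖(0 : ℝ → EuclideanSpace ℝ (Fin 3) → EuclideanSpace ℝ (Fin 3)) τ y‖ ≤
        C / Real.sqrt (-(t / 2)) := fun τ _ y => by
    simpa using hM0
  have hu : ∀ τ ∈ Ioo s₀ (t / 2), v τ =ᵐ[volume] fun x =>
      UnboundedOperators.heatExtension (v s₀) (τ - s₀) x - oseenDuhamel 1 s₀ v v τ x :=
    fun τ hτ => Eventually.of_forall fun x => hmild s₀ τ hτ.1 (hτ.2.trans hT0) x
  have hv : ∀ τ ∈ Ioo s₀ (t / 2),
      (0 : ℝ → EuclideanSpace ℝ (Fin 3) → EuclideanSpace ℝ (Fin 3)) τ =ᵐ[volume] fun x =>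
        UnboundedOperators.heatExtension (v s₀) (τ - s₀) x - oseenDuhamel 1 s₀ 0 0 τ x :=
    fun τ _ => Eventually.of_forall fun x => by
      simp [hz, UnboundedOperators.heatExtension_zero_fun]
  have huniq := oseenMild_bounded_unique
    (U := fun τ x => UnboundedOperators.heatExtension (v s₀) (τ - s₀) x)
    one_pos hM0 hum hzm huM hvM hu hv t ⟨hst, htT⟩
  -- `v t = 0` a.e., hence everywhere by continuity of the slice
  have hct : Continuous (v t) :=
    hvcont.comp_continuous (Continuous.prodMk_right t) fun _ => ⟨ht0, mem_univ _⟩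
  have heq : v t = fun _ => 0 := Measure.eq_of_ae_eq huniq hct continuous_const
  intro x
  exact congrFun heq x

/-! ### The stub -/

/-- **PARABOLIC ACTIVITY AT A SINGULAR POINT** (Barker–Prange 2020 Thm 2, slab-class qualitative
form): for every class `(C, I)`, `I < ⊤`, there are `η > 0` and `ρ > 0` such that every continuous
class profile that is backward-singular at the origin is `η`-ACTIVE somewhere in the unit band
below the vertex: some `t ∈ (-2, -1)` and `‖x‖ ≤ ρ` with `√(−t) ‖u(t,x)‖ ≥ η`. (Compactness +
persistence + a.e. vanishing on the band + continuity + uniqueness of bounded Oseen-mild solutions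
with zero data: a profile vanishing on a time band vanishes afterwards, hence is regular at the
origin.) [cite: BarkerPrange2020, Thm. 2 (arXiv:1812.09115, pp. 4–5), qualitative slab form]
[cite: AlbrittonBarker2019, Lemma 2.2, Prop. 2.3 and §3] -/
theorem stub_parabolicActivity :
    ∀ (C : ℝ) (I : ℝ≥0∞), I < ⊤ → ∃ η : ℝ, 0 < η ∧ ∃ ρ : ℝ, 0 < ρ ∧
      ∀ (u : ℝ → (EuclideanSpace ℝ (Fin 3)) → (EuclideanSpace ℝ (Fin 3))) (p : ℝ → (EuclideanSpace ℝ (Fin 3)) → ℝ)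
        (G : ℝ → (EuclideanSpace ℝ (Fin 3)) → (EuclideanSpace ℝ (Fin 3)) →L[ℝ] (EuclideanSpace ℝ (Fin 3))),
        IsSuitableWeakSolutionOn (slab (EuclideanSpace ℝ (Fin 3)) (Iio 0) isOpen_Iio) 1 0 u p →
        HasWeakSpatialGradientOn (slab (EuclideanSpace ℝ (Fin 3)) (Iio 0) isOpen_Iio) u G →
        typeIBound (Iio (0 : ℝ) ×ˢ univ) u p G ≤ I →
        HasTypeITimeDecay C u →
        ContinuousOn (uncurry u) (Iio (0 : ℝ) ×ˢ univ) →
        IsBackwardSingularPoint u 0 →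
        ∃ t : ℝ, t ∈ Ioo (-2 : ℝ) (-1) ∧ ∃ x : EuclideanSpace ℝ (Fin 3), ‖x‖ ≤ ρ ∧
          η ≤ Real.sqrt (-t) * ‖u t x‖ := by
  intro C I hI
  by_contra h
  push Not at h
  -- ## Step 1: violators for `η_k = 1/(k+1)`, `ρ_k = k+1`
  have hpos : ∀ k : ℕ, (0 : ℝ) < (k : ℝ) + 1 := fun k => by positivity
  have hη : ∀ k : ℕ, (0 : ℝ) < 1 / ((k : ℝ) + 1) := fun k => by positivity
  choose u p G hsw hwg hIle hC _hcont hsing hquiet using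
    fun k : ℕ => h (1 / ((k : ℝ) + 1)) (hη k) ((k : ℝ) + 1) (hpos k)
  -- `0 ≤ C` (the rate of `u 0` at `(t, x) = (-1, 0)`)
  have hC0 : 0 ≤ C := by
    have h := hC 0 (-1) (by norm_num) 0
    rw [neg_neg, Real.sqrt_one, div_one] at h
    exact (norm_nonneg _).trans h
  -- ## Step 2: the ENGINE on the sequence itself; persistence at the fixed origin
  obtain ⟨v₀, q, H, σ, hσ, hsw₀, hwg₀, hI₀, hconv₀, hpers₀⟩ :=
    slab_typeI_compactness I u p G hI hsw hwg hIle
  have hsing₀ : IsBackwardSingularPoint v₀ 0 := by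
    refine hpers₀ fun R hR => ?_
    have hconst : (fun j => eLpNorm (uncurry (u (σ j))) ⊤
        (volume.restrict (parabolicCylinder R (0 : ℝ × (EuclideanSpace ℝ (Fin 3)))))) =
        fun _ => (⊤ : ℝ≥0∞) :=
      funext fun j => hsing (σ j) R hR
    rw [hconst]
    exact limsup_const ⊤
  -- ## Step 3: the rate a.e., a representative with the pointwise rate, a continuous mild one
  have hrate₀ : ∀ᵐ z ∂(volume.restrict (Iio (0 : ℝ) ×ˢ (univ : Set (EuclideanSpace ℝ (Fin 3))))),
      ‖v₀ z.1 z.2‖ ≤ C / Real.sqrt (-z.1) :=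
    ae_rate_of_tendsto_eLpNorm (W := fun j => u (σ j))
      (fun j => (hwg (σ j)).locallyIntegrableOn.aestronglyMeasurable)
      hwg₀.locallyIntegrableOn.aestronglyMeasurable (fun j => hC (σ j))
      (fun n => hconv₀ ((n : ℝ) + 1) (by positivity))
  obtain ⟨v₁, hae₁, hC₁⟩ := exists_repr_hasTypeITimeDecay hC0 hrate₀
  obtain ⟨hsw₁, hwg₁, hI₁, hsing₁, hconv₁⟩ := classData_congr_ae hae₁ hsw₀ hwg₀ hI₀ hsing₀ hconv₀
  have hI₁top : typeIBound (Iio (0 : ℝ) ×ˢ univ) v₁ q H < ⊤ :=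
    lt_of_le_of_lt hI₁ (ENNReal.mul_lt_top (by simp) hI)
  obtain ⟨v, hae₂, hvcont, -, hmild, hvC⟩ :=
    exists_oseenMild_repr_of_typeIBound_lt_top hsw₁ hC₁ hI₁top
  obtain ⟨-, hwgv, -, hsingv, hconvv⟩ := classData_congr_ae hae₂ hsw₁ hwg₁ hI₁ hsing₁ hconv₁
  -- ## Step 4: the approximants vanish pointwise on the band, so `v = 0` a.e. there
  have hpt : ∀ z ∈ Ioo (-2 : ℝ) (-1) ×ˢ (univ : Set (EuclideanSpace ℝ (Fin 3))),
      Tendsto (fun j => uncurry (u (σ j)) z) atTop (𝓝 0) := by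
    rintro z ⟨hz, -⟩
    have h1 : 1 ≤ Real.sqrt (-z.1) := Real.one_le_sqrt.2 (by linarith [hz.2])
    have hεσ : Tendsto (fun j => 1 / (((σ j : ℕ) : ℝ) + 1)) atTop (𝓝 0) :=
      tendsto_one_div_add_atTop_nhds_zero_nat.comp hσ.tendsto_atTop
    have hinv : Tendsto (fun j => ((σ j : ℕ) : ℝ) + 1) atTop atTop :=
      tendsto_atTop_add_const_right _ _ (tendsto_natCast_atTop_atTop.comp hσ.tendsto_atTop)
    refine squeeze_zero_norm' ?_ hεσ
    filter_upwards [hinv.eventually_ge_atTop ‖z.2‖] with j hj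
    calc ‖uncurry (u (σ j)) z‖ = ‖u (σ j) z.1 z.2‖ := rfl
      _ ≤ Real.sqrt (-z.1) * ‖u (σ j) z.1 z.2‖ := le_mul_of_one_le_left (norm_nonneg _) h1
      _ ≤ 1 / (((σ j : ℕ) : ℝ) + 1) := (hquiet (σ j) z.1 hz z.2 hj).le
  have hae0 : ∀ᵐ z ∂(volume.restrict (Iio (0 : ℝ) ×ˢ (univ : Set (EuclideanSpace ℝ (Fin 3))))),
      z ∈ Ioo (-2 : ℝ) (-1) ×ˢ (univ : Set (EuclideanSpace ℝ (Fin 3))) → uncurry v z = 0 :=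
    ae_zero_of_tendsto_zero_of_tendsto_eLpNorm (W := fun j => u (σ j))
      (fun j => (hwg (σ j)).locallyIntegrableOn.aestronglyMeasurable)
      hwgv.locallyIntegrableOn.aestronglyMeasurable hpt
      (fun n => hconvv ((n : ℝ) + 1) (by positivity))
  -- ## Step 5: `v = 0` on the band (continuity), then after it (forward uniqueness)
  have hband : ∀ t ∈ Ioo (-2 : ℝ) (-1), ∀ x : EuclideanSpace ℝ (Fin 3), v t x = 0 :=
    band_zero_of_ae_zero_of_continuousOn (by norm_num) hvcont hae0
  have hafter : ∀ t : ℝ, (-3 / 2 : ℝ) < t → t < 0 → ∀ x : EuclideanSpace ℝ (Fin 3), v t x = 0 :=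
    zero_after_zero_slice_of_oseenMild (by norm_num) hvcont hvC hmild
      (hband (-3 / 2) ⟨by norm_num, by norm_num⟩)
  -- ## Step 6: contradiction — `‖v‖_{L^∞(Q(0,1))} = 0 ≠ ∞`
  have hQm : MeasurableSet (parabolicCylinder 1 (0 : ℝ × (EuclideanSpace ℝ (Fin 3)))) :=
    (isOpen_parabolicCylinder _ _).measurableSet
  have hv0' : uncurry v
      =ᵐ[volume.restrict (parabolicCylinder 1 (0 : ℝ × (EuclideanSpace ℝ (Fin 3))))]
      (0 : ℝ × (EuclideanSpace ℝ (Fin 3)) → (EuclideanSpace ℝ (Fin 3))) := by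
    refine (ae_restrict_mem hQm).mono fun z hz => ?_
    simp only [mem_parabolicCylinder, Prod.fst_zero, Prod.snd_zero] at hz
    have hz1 : (-3 / 2 : ℝ) < z.1 := by linarith [hz.1.1]
    exact hafter z.1 hz1 hz.1.2 z.2
  have hzero : eLpNorm (uncurry v) ⊤
      (volume.restrict (parabolicCylinder 1 (0 : ℝ × (EuclideanSpace ℝ (Fin 3))))) = 0 := by
    rw [eLpNorm_congr_ae hv0', eLpNorm_zero]
  have htop : eLpNorm (uncurry v) ⊤
      (volume.restrict (parabolicCylinder 1 (0 : ℝ × (EuclideanSpace ℝ (Fin 3))))) = ⊤ :=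
    hsingv 1 one_pos
  rw [hzero] at htop
  exact ENNReal.zero_ne_top htop

end Summit.NavierStokesRegularity.NavierStokesRegularity.Theorems.RellichScarApexLocalisation
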